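import Literature.NumberTheory.EllipticCurves.BigRepModuleDualShiftedEndomorphismCofinitelyGeneratedProofs
import Literature.NumberTheory.EllipticCurves.TateModuleFree
import Literature.NumberTheory.EllipticCurves.TateModuleProofs
import Literature.NumberTheory.EllipticCurves.TateModuleComparisonProofs
import Literature.NumberTheory.EllipticCurves.PrimaryTorsionGaloisRep
import Literature.NumberTheory.IwasawaTheory.PruferPontryaginDual
import Mathlib.Algebra.Module.CharacterModule
import HarnessLib

/-!
# The Pontryagin dual of a cofinitely generated `p`-primary module versus its TATE MODULE:
# `charpoly(F^∨ on B^∨ ⧸ tors) = charpoly(T_p F on T_p B)` — PROVED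

Topic `Literature/NumberTheory/EllipticCurves` (namespace = path + `TateModule` / `BigRepModule`).
THEOREMS ONLY: no definition, no named fact, no instance, no `sorry`. Cell `bsd-stepL` (typer lane
`defn-ty1`, g11): module L5 step **(S5)** of the discharge of the local atom
`JetchevSkinnerWan2017.sigmaLocal_charIdeal_eulerFactor_mem_of_noTamagawaDefect` (K2 support 20495)
at a finitely decomposed place of GOOD ∕ MULTIPLICATIVE reduction: the intrinsic generator
`(charpoly Lt).reverse((1+T)^{−c})` of `JetchevSkinnerWan2017.sigmaLocal_dual_of_ne_zero` ∕
`BigRepModule.finite_isTorsion_charIdeal_characterModule_ker_shiftedEndo_eq_span_aeval` (there `Lt` is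
the dual Frobenius on `H¹(I_w, E[p^∞])^∨ ⧸ tors`) is to be read on a TATE MODULE, where the tree
knows the characteristic polynomial of Frobenius (`charpoly_galoisRepTate_of_hasGoodReductionAt`,
`trace_/det_galoisRepTate_frobenius_of_hasGoodReductionAt_holds`, on `W.tateModule p =
TateModule (geomPoints W) p`).

## The printed statement

[GreenbergVatsal2000] §2, proof of Prop. (2.4) (arXiv p. 22): "`H¹(Ī_ℓ, A_{J_ℓ}) = … ≅
Hom(ℤ_ℓ(1), A_{I_ℓ}) ≅ A_{I_ℓ}(−1)` … The eigenvalues of `Frob_ℓ` acting on `A_{I_ℓ}(−1)̂` are the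
numbers `ℓα_i^{−1}`, `1 ≤ i ≤ e_ℓ`" (where `α_1, …, α_{e_ℓ}` are "the eigenvalues of `Frob_ℓ` … acting on
`(V_p)_{I_ℓ}`", p. 21), whence Prop. (2.4): "Let `P_ℓ(X) = det((1 − Frob_ℓ X)|_{(V_p)_{I_ℓ}}) ∈ 𝒪[X]`. Let
`𝓟_ℓ = P_ℓ(ℓ^{−1}γ_ℓ)` … The characteristic ideal of the `Λ`-module `ℋ_ℓ(ℚ_∞)̂` is generated by `𝓟_ℓ`."
The step "eigenvalues on the Pontryagin dual `Â'` of a discrete cofinitely generated `A'` = eigenvalues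
on the lattice ∕ `V_p`" is the content of this file, in the form: the Pontryagin dual of `B` modulo
torsion and the Tate module `T_p B = lim B[p^n]` are `ℤ_p`-lattices of the same rank in duality,
compatibly with every endomorphism of `B`, so the two characteristic polynomials agree (and p. 23:
"Its Pontryagin dual is a torsion-free, finitely generated `𝒪`-module and must therefore be free").

## What is proved (`B` a `p`-primary `ℤ_p`-module, `X = B^∨ = CharacterModule B`, `Y = X ⧸ X_tors`,
## `T = TateModule B p` the tree's Tate module of compatible sequences)

* §0–§1 **the evaluation pairing** `T × X → ℤ_p`: for `t = (t_n) ∈ T` and a character `χ`,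
  `χ(t_n) = a_n / p^n ∈ ℚ/ℤ` with compatible residues `a_n mod p^n`, glued by the tree's `toPadicInt`
  (`exists_pairingFun`); the residues determine the value (`padicInt_eq_of_residues`), whence
  bi-additivity and `ℤ_p`-bilinearity (`exists_pairing`: a `ℤ_p`-bilinear
  `P : T →ₗ X →ₗ ℤ_p` with `P t χ ≡ a (mod p^n)` whenever `χ(t_n) = a/p^n`; all later statements
  quantify over any such `P`);
* §2 `P (T_p F · t) χ = P t (χ ∘ F)` (`pairing_map`), torsion characters pair to `0`
  (`pairing_eq_zero_of_mem_torsion`), LEFT non-degeneracy `(∀ χ, P t χ = 0) → t = 0`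
  (`eq_zero_of_forall_pairing_eq_zero`, characters separate points);
* §3 RIGHT non-degeneracy modulo torsion for COFINITELY GENERATED `B`
  (`[Module.Finite ℤ_[p] (CharacterModule B)]`): the divisible part `B_div = (X_tors)^⊥` of the tree's
  `BigRepModule.exists_submodule_mem_iff_torsion` is `p`-divisible (`exists_smul_eq_of_mem_iff_torsion`:
  `Y` torsion-free ⟹ `B_div ⧸ p·B_div` has no non-zero character), every element of it is a
  component of an element of `T` (`exists_proj_eq_of_divisible`), so `(∀ t, P t χ = 0) → χ ∈ X_tors`
  (`mem_torsion_of_forall_pairing_eq_zero`);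
* §4 the comparison map `ι : Y → Hom_{ℤ_p}(T, ℤ_p)` and its flip `T → Hom_{ℤ_p}(Y, ℤ_p)` are
  injective (`liftQ_flip_injective`, `flip_liftQ_flip_injective`), `ι` intertwines `Lt` with the
  transpose of `T_p F` (`liftQ_flip_comp_eq_dualMap_comp`), and **`rank_{ℤ_p} Y = rank_{ℤ_p} T`**
  (`finrank_quotientTorsion_characterModule_eq_finrank_tateModule`);
* §5 linear algebra over a domain: INTERTWINED LATTICES OF EQUAL RANK HAVE EQUAL CHARACTERISTIC
  POLYNOMIAL (`LinearMap.charpoly_eq_of_injective_of_finrank_eq`: `ι ∘ g = f ∘ ι`, `ι` injective,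
  equal finranks ⟹ `charpoly g = charpoly f`, by `(X − A)Q = Q(X − C)`, `det Q ≠ 0`), and
  `charpoly f.dualMap = charpoly f` (`LinearMap.charpoly_dualMap`);
* §6 **THE BRIDGE** `BigRepModule.charpoly_quotientTorsion_endo_dual_eq_charpoly_tateModule_map`:
  for `B` `p`-primary cofinitely generated, `F_B : B →ₗ B`, and `Lt` on `Y` with
  `Lt [χ] = [χ ∘ F_B]` (exists: `BigRepModule.exists_quotientTorsion_endo_dual`):
  **`charpoly Lt = charpoly (TateModule.map p F_B)`**;
* §7 `B` cofinitely generated ⟹ `B[p]` finite (`finite_torsionBy_of_module_finite_characterModule`) ⟹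
  `T_p B` finitely generated and free (`module_finite/free_of_module_finite_characterModule`, tree
  `TateModule.finite/free_of_finite_torsionBy`), and the bridge with these instances supplied
  (`…_eq_charpoly_tateModule_map'`);
* §8 `T_p(A[p^∞]) ≅ T_p(A)` for the tree's `PrimaryTorsion A p` (`exists_linearEquiv_primaryTorsion`,
  components `(e t)_n = t_n`), natural for compatible endomorphisms (`linearEquiv_primaryTorsion_map`),
  hence `charpoly (T_p f) = charpoly (T_p g)` when `(f x : A) = g x`
  (`charpoly_map_primaryTorsion_eq_charpoly_map`) — e.g. `E.primaryTorsionGaloisRep p σ` versus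
  `W.galoisRepTate p σ` on `W.tateModule p`.

HOW A CONSUMER USES IT (K2 support 20495, good place `w ∤ p`, `c = κ(φ) ≠ 0`): with
`B = H¹(I_w, E[p^∞])` identified with `E[p^∞]` (trivial inertia action; `F_B = q_w⁻¹ · φ`, GV00 p. 22
`A_{I_ℓ}(−1)`), `charpoly Lt = charpoly (T_p F_B)` (§6) `= charpoly (q_w⁻¹ · ρ_{T_pE}(φ))` (§8 +
`LinearEquiv.charpoly_conj`), and `charpoly ρ_{T_pE}(φ) = X² − a_w X + q_w`
(`charpoly_galoisRepTate_of_hasGoodReductionAt`).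

HONEST FRAMING: pure `ℤ_p`-module algebra (Pontryagin duality of `ℚ/ℤ`-characters versus the Tate
module); nothing about Galois cohomology, Euler factors or BSD is proved here and the named local
fact is NOT discharged by this file.

References: [GreenbergVatsal2000] §2, proof of Prop. (2.4) (arXiv:math/9906215 pp. 21–23; cell
deposit `HOME/lit/GV00_Invent142_arXivPS_decoded_g30/GV00_sec2_decoded.txt`); [GreenbergLNM1716] §3
(proof of Lemma 3.3: `B_v ≅ (ℚ_p/ℤ_p)^e × finite`); [SilvermanAEC2009] III.§7, Prop. III.7.1 (the
Tate module is free of finite rank); [Serre1968] Ch. I §1.2 (`E_{ℓ^∞}`, `T_ℓ = lim E_{ℓⁿ}`).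
-/

noncomputable section

open scoped Classical

universe u

namespace Literature.NumberTheory.EllipticCurves

namespace TateModule

open Literature.NumberTheory.IwasawaTheory

section General

variable {B : Type u} [AddCommGroup B] {p : ℕ} [Fact p.Prime]

/-! ## §0 Residues of `p^n`-torsion elements of `ℚ/ℤ` -/

/-- The value of a character at the `n`-th component of an element of `T_p B` is a class
`a / p^n ∈ ℚ/ℤ`. [folklore] -/
private theorem exists_apply_proj_eq_coe_div (t : TateModule B p) (χ : CharacterModule B) (n : ℕ) :
    ∃ a : ℤ, χ (proj p n t) = (((a : ℚ) / (p : ℚ) ^ n : ℚ) : AddCircle (1 : ℚ)) :=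
  QpModZp.addCircle_exists_eq_coe_int_div_of_nsmul_eq_zero (p := p)
    (by rw [← map_nsmul, pow_smul_proj, map_zero])

/-- `p^k • (a / p^(n+k)) = a / p^n` in `ℚ/ℤ`. [folklore] -/
private theorem pow_nsmul_coe_div_add (a : ℤ) (n k : ℕ) :
    p ^ k • ((((a : ℚ) / (p : ℚ) ^ (n + k) : ℚ)) : AddCircle (1 : ℚ)) =
      (((a : ℚ) / (p : ℚ) ^ n : ℚ) : AddCircle (1 : ℚ)) := by
  have hp0 : (p : ℚ) ≠ 0 := Nat.cast_ne_zero.2 (Fact.out : p.Prime).ne_zero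
  rw [← AddCircle.coe_nsmul]
  congr 1
  rw [nsmul_eq_mul, pow_add]
  field_simp
  push_cast
  ring

/-- The classes `a / p^n` chosen at different levels of a compatible sequence are compatible:
if `χ(t_n) = a / p^n` and `χ(t_{n+k}) = b / p^{n+k}` then `b ≡ a (mod p^n)`. [folklore] -/
private theorem intCast_eq_intCast_of_apply_proj_eq (t : TateModule B p) (χ : CharacterModule B)
    {n k : ℕ} {a b : ℤ}
    (ha : χ (proj p n t) = (((a : ℚ) / (p : ℚ) ^ n : ℚ) : AddCircle (1 : ℚ)))
    (hb : χ (proj p (n + k) t) = (((b : ℚ) / (p : ℚ) ^ (n + k) : ℚ) : AddCircle (1 : ℚ))) :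
    (b : ZMod (p ^ n)) = (a : ZMod (p ^ n)) := by
  rw [← QpModZp.addCircle_coe_int_div_eq_coe_int_div_iff (p := p), ← ha, ← pow_smul_proj_add t n k,
    map_nsmul, hb, pow_nsmul_coe_div_add]

/-! ## §1 The evaluation pairing: existence and uniqueness of its values -/

/-- **Existence of the evaluation pairing, as a function.** There is `P₀ : T_p B → B^∨ → ℤ_p` with
`P₀ t χ ≡ a (mod p^n)` whenever `χ(t_n) = a / p^n`: the residues `a mod p^n` are compatible and glue
to an element of `ℤ_p = lim ℤ/p^n` (tree `toPadicInt`). This is the canonical pairing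
`T_p B × Hom(B, ℚ_p/ℤ_p) → End(ℚ_p/ℤ_p) = ℤ_p`, `(t, χ) ↦ χ ∘ t` for `t ∈ T_p B = Hom(ℚ_p/ℤ_p, B)`.
[cite: GreenbergVatsal2000, proof of Prop. 2.4 (arXiv p. 22: the lattice dual to a divisible module)] -/
private theorem exists_pairingFun (B : Type u) [AddCommGroup B] (p : ℕ) [Fact p.Prime] :
    ∃ P₀ : TateModule B p → CharacterModule B → ℤ_[p],
      ∀ (t : TateModule B p) (χ : CharacterModule B) (n : ℕ) (a : ℤ),
        χ (proj p n t) = (((a : ℚ) / (p : ℚ) ^ n : ℚ) : AddCircle (1 : ℚ)) →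
          PadicInt.toZModPow n (P₀ t χ) = a := by
  have hex := fun (t : TateModule B p) (χ : CharacterModule B) (n : ℕ) =>
    exists_apply_proj_eq_coe_div t χ n
  choose a ha using hex
  have hcompat : ∀ (t : TateModule B p) (χ : CharacterModule B),
      (fun n => (a t χ n : ZMod (p ^ n))) ∈ compatSeqSubring p := by
    intro t χ m n hmn
    obtain ⟨k, rfl⟩ := Nat.exists_eq_add_of_le hmn
    rw [ZMod.castHom_apply, ZMod.cast_intCast (pow_dvd_pow p hmn)]
    exact intCast_eq_intCast_of_apply_proj_eq t χ (ha t χ m) (ha t χ (m + k))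
  refine ⟨fun t χ => toPadicInt p ⟨_, hcompat t χ⟩, fun t χ n b hb => ?_⟩
  rw [toZModPow_toPadicInt]
  change (a t χ n : ZMod (p ^ n)) = b
  have h := intCast_eq_intCast_of_apply_proj_eq t χ (k := 0) hb (by simpa using ha t χ n)
  exact h

/-- **The residues determine the value**: two `p`-adic integers with the residue property for the
same `(t, χ)` are equal. [folklore] -/
private theorem padicInt_eq_of_residues (t : TateModule B p) (χ : CharacterModule B) {x y : ℤ_[p]}
    (hx : ∀ (n : ℕ) (a : ℤ), χ (proj p n t) = (((a : ℚ) / (p : ℚ) ^ n : ℚ) : AddCircle (1 : ℚ)) →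
      PadicInt.toZModPow n x = a)
    (hy : ∀ (n : ℕ) (a : ℤ), χ (proj p n t) = (((a : ℚ) / (p : ℚ) ^ n : ℚ) : AddCircle (1 : ℚ)) →
      PadicInt.toZModPow n y = a) :
    x = y := by
  refine PadicInt.ext_of_toZModPow.mp fun n => ?_
  obtain ⟨a, ha⟩ := exists_apply_proj_eq_coe_div t χ n
  rw [hx n a ha, hy n a ha]

section Bilinear

variable {P₀ : TateModule B p → CharacterModule B → ℤ_[p]}

/-- Additivity in the character. [folklore] -/
private theorem pairingFun_add_right
    (hP : ∀ (t : TateModule B p) (χ : CharacterModule B) (n : ℕ) (a : ℤ),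
      χ (proj p n t) = (((a : ℚ) / (p : ℚ) ^ n : ℚ) : AddCircle (1 : ℚ)) →
        PadicInt.toZModPow n (P₀ t χ) = a)
    (t : TateModule B p) (χ ψ : CharacterModule B) :
    P₀ t (χ + ψ) = P₀ t χ + P₀ t ψ := by
  refine PadicInt.ext_of_toZModPow.mp fun n => ?_
  obtain ⟨a, ha⟩ := exists_apply_proj_eq_coe_div t χ n
  obtain ⟨b, hb⟩ := exists_apply_proj_eq_coe_div t ψ n
  have hab : (χ + ψ) (proj p n t) = ((((a + b : ℤ) : ℚ) / (p : ℚ) ^ n : ℚ) : AddCircle (1 : ℚ)) := by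
    rw [show (χ + ψ) (proj p n t) = χ (proj p n t) + ψ (proj p n t) from rfl, ha, hb,
      ← AddCircle.coe_add, Int.cast_add, add_div]
  rw [map_add, hP t χ n a ha, hP t ψ n b hb, hP t (χ + ψ) n (a + b) hab, Int.cast_add]

/-- Additivity in the Tate-module variable. [folklore] -/
private theorem pairingFun_add_left
    (hP : ∀ (t : TateModule B p) (χ : CharacterModule B) (n : ℕ) (a : ℤ),
      χ (proj p n t) = (((a : ℚ) / (p : ℚ) ^ n : ℚ) : AddCircle (1 : ℚ)) →
        PadicInt.toZModPow n (P₀ t χ) = a)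
    (s t : TateModule B p) (χ : CharacterModule B) :
    P₀ (s + t) χ = P₀ s χ + P₀ t χ := by
  refine PadicInt.ext_of_toZModPow.mp fun n => ?_
  obtain ⟨a, ha⟩ := exists_apply_proj_eq_coe_div s χ n
  obtain ⟨b, hb⟩ := exists_apply_proj_eq_coe_div t χ n
  have hab : χ (proj p n (s + t)) = ((((a + b : ℤ) : ℚ) / (p : ℚ) ^ n : ℚ) : AddCircle (1 : ℚ)) := by
    rw [map_add, map_add, ha, hb, ← AddCircle.coe_add, Int.cast_add, add_div]
  rw [map_add, hP s χ n a ha, hP t χ n b hb, hP (s + t) χ n (a + b) hab, Int.cast_add]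

/-- The residue of a `p`-adic integer: `toZModPow n x = x.appr n`. [folklore] -/
private theorem toZModPow_eq_natCast_appr (x : ℤ_[p]) (n : ℕ) :
    PadicInt.toZModPow n x = (x.appr n : ZMod (p ^ n)) :=
  rfl

/-- `ℤ_p`-homogeneity in the Tate-module variable: `P₀ (x • t) χ = x * P₀ t χ`
(`(x • t)_n = (x mod p^n) • t_n`). [folklore] -/
private theorem pairingFun_smul_left
    (hP : ∀ (t : TateModule B p) (χ : CharacterModule B) (n : ℕ) (a : ℤ),
      χ (proj p n t) = (((a : ℚ) / (p : ℚ) ^ n : ℚ) : AddCircle (1 : ℚ)) →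
        PadicInt.toZModPow n (P₀ t χ) = a)
    (x : ℤ_[p]) (t : TateModule B p) (χ : CharacterModule B) :
    P₀ (x • t) χ = x * P₀ t χ := by
  refine PadicInt.ext_of_toZModPow.mp fun n => ?_
  obtain ⟨a, ha⟩ := exists_apply_proj_eq_coe_div t χ n
  have hxa : χ (proj p n (x • t)) =
      ((((x.appr n * a : ℤ) : ℚ) / (p : ℚ) ^ n : ℚ) : AddCircle (1 : ℚ)) := by
    rw [proj_smul, map_nsmul, ha, ← AddCircle.coe_nsmul, toZModPow_eq_natCast_appr, ZMod.val_natCast,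
      Nat.mod_eq_of_lt (PadicInt.appr_lt x n), nsmul_eq_mul, Int.cast_mul, Int.cast_natCast, mul_div_assoc]
  rw [map_mul, hP t χ n a ha, hP (x • t) χ n _ hxa, Int.cast_mul, Int.cast_natCast,
    toZModPow_eq_natCast_appr]

/-- For a `ℤ_p`-module `B` and a `p^n`-torsion element `b`, any `ℤ_p`-module structure acts through
`ℤ/p^n`: `x • b = (x.appr n) • b`. [folklore] -/
private theorem smul_eq_appr_nsmul [Module ℤ_[p] B] (x : ℤ_[p]) {b : B} {n : ℕ} (hb : p ^ n • b = 0) :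
    x • b = x.appr n • b := by
  obtain ⟨y, hy⟩ := Ideal.mem_span_singleton'.1 (PadicInt.appr_spec n x)
  have hx : x = (x.appr n : ℤ_[p]) + y * (p : ℤ_[p]) ^ n := by rw [hy]; ring
  conv_lhs => rw [hx]
  rw [add_smul, mul_smul, ← Nat.cast_pow, Nat.cast_smul_eq_nsmul ℤ_[p] (p ^ n), hb, smul_zero,
    add_zero, Nat.cast_smul_eq_nsmul]

/-- `ℤ_p`-homogeneity in the character, for a `p`-primary `ℤ_p`-module `B` (Mathlib's module
structure on `CharacterModule B`: `(x • χ) b = χ (x • b)`). [folklore] -/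
private theorem pairingFun_smul_right [Module ℤ_[p] B]
    (hP : ∀ (t : TateModule B p) (χ : CharacterModule B) (n : ℕ) (a : ℤ),
      χ (proj p n t) = (((a : ℚ) / (p : ℚ) ^ n : ℚ) : AddCircle (1 : ℚ)) →
        PadicInt.toZModPow n (P₀ t χ) = a)
    (x : ℤ_[p]) (t : TateModule B p) (χ : CharacterModule B) :
    P₀ t (x • χ) = x * P₀ t χ := by
  refine PadicInt.ext_of_toZModPow.mp fun n => ?_
  obtain ⟨a, ha⟩ := exists_apply_proj_eq_coe_div t χ n
  have hxa : (x • χ) (proj p n t) =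
      ((((x.appr n * a : ℤ) : ℚ) / (p : ℚ) ^ n : ℚ) : AddCircle (1 : ℚ)) := by
    rw [CharacterModule.smul_apply, smul_eq_appr_nsmul x (pow_smul_proj n t), map_nsmul, ha,
      ← AddCircle.coe_nsmul, nsmul_eq_mul, Int.cast_mul, Int.cast_natCast, mul_div_assoc]
  rw [map_mul, hP t χ n a ha, hP t (x • χ) n _ hxa, Int.cast_mul, Int.cast_natCast,
    toZModPow_eq_natCast_appr]

end Bilinear

/-- **The evaluation pairing `T_p B × B^∨ → ℤ_p` as a `ℤ_p`-bilinear map** (for a `p`-primary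
`ℤ_p`-module `B`; `B^∨ = CharacterModule B` with Mathlib's `ℤ_p`-structure), characterised by its
residues: `P t χ ≡ a (mod p^n)` whenever `χ(t_n) = a/p^n` — the duality between the Pontryagin dual
`Â'` of a discrete `p`-primary module and its Tate module used in "the eigenvalues of `Frob_ℓ` acting
on `A_{I_ℓ}(−1)̂` are the numbers `ℓα_i^{−1}`".
[cite: GreenbergVatsal2000, §2, proof of Prop. (2.4) (arXiv p. 22)] -/
theorem exists_pairing (B : Type u) [AddCommGroup B] (p : ℕ) [Fact p.Prime] [Module ℤ_[p] B] :
    ∃ P : TateModule B p →ₗ[ℤ_[p]] CharacterModule B →ₗ[ℤ_[p]] ℤ_[p],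
      ∀ (t : TateModule B p) (χ : CharacterModule B) (n : ℕ) (a : ℤ),
        χ (proj p n t) = (((a : ℚ) / (p : ℚ) ^ n : ℚ) : AddCircle (1 : ℚ)) →
          PadicInt.toZModPow n (P t χ) = a := by
  obtain ⟨P₀, hP⟩ := exists_pairingFun B p
  refine ⟨LinearMap.mk₂ ℤ_[p] P₀ (pairingFun_add_left hP) (fun x t χ => ?_) (pairingFun_add_right hP)
    (fun x t χ => ?_), fun t χ n a h => hP t χ n a h⟩
  · rw [pairingFun_smul_left hP, smul_eq_mul]
  · rw [pairingFun_smul_right hP, smul_eq_mul]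

/-! ## §2 Properties of the pairing -/

section Properties

variable [Module ℤ_[p] B] {P : TateModule B p →ₗ[ℤ_[p]] CharacterModule B →ₗ[ℤ_[p]] ℤ_[p]}

/-- **Adjointness / naturality**: `⟨T_p(F) t, χ⟩ = ⟨t, χ ∘ F⟩` for an endomorphism `F` of `B`
(`(T_p F t)_n = F(t_n)`; "the isomorphisms are equivariant for the action of `Gal(ℚ_ℓ^{unr}/ℚ_ℓ)`").
[cite: GreenbergVatsal2000, §2, proof of Prop. (2.4) (arXiv p. 22)] -/
theorem pairing_map (hP : ∀ (t : TateModule B p) (χ : CharacterModule B) (n : ℕ) (a : ℤ),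
      χ (proj p n t) = (((a : ℚ) / (p : ℚ) ^ n : ℚ) : AddCircle (1 : ℚ)) →
        PadicInt.toZModPow n (P t χ) = a)
    (F : B →ₗ[ℤ_[p]] B) (t : TateModule B p) (χ : CharacterModule B) :
    P (map p F.toAddMonoidHom t) χ = P t (CharacterModule.dual F χ) := by
  refine PadicInt.ext_of_toZModPow.mp fun n => ?_
  obtain ⟨a, ha⟩ := exists_apply_proj_eq_coe_div t (CharacterModule.dual F χ) n
  have ha' : χ (proj p n (map p F.toAddMonoidHom t)) = (((a : ℚ) / (p : ℚ) ^ n : ℚ) : AddCircle (1 : ℚ)) := by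
    rw [proj_map]; exact ha
  rw [hP _ _ n a ha', hP _ _ n a ha]

/-- **Torsion characters pair to zero** (`ℤ_p` is a domain). [folklore] -/
private theorem pairing_eq_zero_of_mem_torsion
    (t : TateModule B p) {χ : CharacterModule B} (hχ : χ ∈ Submodule.torsion ℤ_[p] (CharacterModule B)) :
    P t χ = 0 := by
  obtain ⟨a, ha⟩ := (Submodule.mem_torsion_iff χ).1 hχ
  have ha' : (a : ℤ_[p]) • χ = 0 := ha
  have h : (a : ℤ_[p]) * P t χ = 0 := by
    rw [← smul_eq_mul, ← LinearMap.map_smul, ha', map_zero]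
  exact (mul_eq_zero.1 h).resolve_left (nonZeroDivisors.coe_ne_zero a)

/-- **Left non-degeneracy**: if `⟨t, χ⟩ = 0` for every character `χ` then `t = 0` (a non-zero
component `t_n` is detected by some character of `B`, Mathlib
`CharacterModule.exists_character_apply_ne_zero_of_ne_zero`). [folklore] -/
private theorem eq_zero_of_forall_pairing_eq_zero
    (hP : ∀ (t : TateModule B p) (χ : CharacterModule B) (n : ℕ) (a : ℤ),
      χ (proj p n t) = (((a : ℚ) / (p : ℚ) ^ n : ℚ) : AddCircle (1 : ℚ)) →
        PadicInt.toZModPow n (P t χ) = a)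
    {t : TateModule B p} (ht : ∀ χ : CharacterModule B, P t χ = 0) : t = 0 := by
  by_contra h0
  obtain ⟨n, hn⟩ : ∃ n, proj p n t ≠ 0 := by
    by_contra! hall
    exact h0 (TateModule.ext fun n => by rw [hall n, map_zero])
  obtain ⟨χ, hχ⟩ := CharacterModule.exists_character_apply_ne_zero_of_ne_zero hn
  obtain ⟨a, ha⟩ := exists_apply_proj_eq_coe_div t χ n
  have hres := hP t χ n a ha
  rw [ht χ, map_zero] at hres
  apply hχ
  have h0' : ((((0 : ℤ) : ℚ) / (p : ℚ) ^ n : ℚ) : AddCircle (1 : ℚ)) = 0 := by simp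
  rw [ha, ← h0', QpModZp.addCircle_coe_int_div_eq_coe_int_div_iff (p := p), Int.cast_zero, ← hres]


end Properties

/-! ## §3 Right non-degeneracy modulo torsion (cofinitely generated `B`) -/

omit [Fact p.Prime] in
/-- **Successive division at level `n`.** If `S ⊆ B` is `p`-divisible inside itself and `d ∈ S` is
killed by `p^n`, then `d = t_n` for some `t ∈ T_p B` (choose `d = d_0`, `p • d_{k+1} = d_k` in `S`;
the compatible sequence is `m ↦ p^n • d_m`). [folklore] -/
private theorem exists_proj_eq_of_divisible (S : Set B) (hS : ∀ d ∈ S, ∃ d' ∈ S, p • d' = d)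
    {d : B} (hd : d ∈ S) {n : ℕ} (hn : p ^ n • d = 0) :
    ∃ t : TateModule B p, proj p n t = d := by
  choose f hf using hS
  let u : ℕ → {a : B // a ∈ S} := fun m ↦
    @Nat.rec (fun _ ↦ {a : B // a ∈ S}) ⟨d, hd⟩ (fun _ b ↦ ⟨f b.1 b.2, (hf b.1 b.2).1⟩) m
  have hu0 : (u 0).1 = d := rfl
  have husucc : ∀ m, p • (u (m + 1)).1 = (u m).1 := fun m ↦ (hf (u m).1 (u m).2).2
  have hpow : ∀ m, p ^ m • (u m).1 = d := by
    intro m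
    induction m with
    | zero => rw [pow_zero, one_smul, hu0]
    | succ k ih => rw [pow_succ, mul_smul, husucc k, ih]
  have h : ∀ m, p ^ m • (p ^ n • (u m).1) = 0 := fun m => by rw [smul_comm, hpow m, hn]
  have h' : ∀ m, p • (p ^ n • (u (m + 1)).1) = p ^ n • (u m).1 := fun m => by
    rw [smul_comm, husucc m]
  exact ⟨mk (fun m ↦ p ^ n • (u m).1) h h', by rw [proj_mk, hpow n]⟩

end General

section Cofinite

variable {p : ℕ} [Fact p.Prime] {B : Type} [AddCommGroup B] [Module ℤ_[p] B]

/-- **The divisible part `B_div = (X_tors)^⊥` is `p`-divisible** for cofinitely generated `B`: its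
Pontryagin dual `Y = X ⧸ X_tors` is torsion-free, so `D ⧸ pD` (whose characters are the
`p`-torsion of `D^∨ ≅ Y`) has no non-zero character, hence vanishes.
[cite: GreenbergLNM1716, §3, proof of Lemma 3.3 (B_v ≅ (ℚ_p/ℤ_p)^e × finite, (B_v)_div)] -/
theorem exists_smul_eq_of_mem_iff_torsion [Module.Finite ℤ_[p] (CharacterModule B)]
    (D : Submodule ℤ_[p] B)
    (hD : ∀ b : B, b ∈ D ↔ ∀ χ ∈ Submodule.torsion ℤ_[p] (CharacterModule B), χ b = 0)
    (d : B) (hd : d ∈ D) : ∃ d' ∈ D, p • d' = d := by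
  obtain ⟨tD, hdual, -⟩ := BigRepModule.exists_isDualPairing_of_mem_iff_torsion D hD
  set N : Submodule ℤ_[p] D := LinearMap.range ((p : ℤ_[p]) • (LinearMap.id : D →ₗ[ℤ_[p]] D))
    with hN
  -- every character of `D ⧸ N` vanishes
  have hvan : ∀ (ψ : CharacterModule (D ⧸ N)) (x : D), ψ (Submodule.Quotient.mk x) = 0 := by
    intro ψ x
    obtain ⟨y, hy⟩ := hdual.bijective.2 (CharacterModule.dual N.mkQ ψ)
    have hmem : ∀ d₁ : D, p • d₁ ∈ N := fun d₁ => by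
      rw [hN, LinearMap.mem_range]
      exact ⟨d₁, by rw [LinearMap.smul_apply, LinearMap.id_apply, Nat.cast_smul_eq_nsmul]⟩
    have hpψ' : p • tD y = 0 := by
      ext d₁
      rw [AddMonoidHom.nsmul_apply, ← map_nsmul, hy, AddMonoidHom.zero_apply,
        CharacterModule.dual_apply, AddMonoidHom.comp_apply, LinearMap.toAddMonoidHom_coe,
        Submodule.mkQ_apply, (Submodule.Quotient.mk_eq_zero N).2 (hmem d₁), map_zero]
    have hpy : (p : ℤ_[p]) • y = 0 := by
      apply hdual.injective
      rw [map_zero, Nat.cast_smul_eq_nsmul, map_nsmul, hpψ']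
    have hy0 : y = 0 :=
      (smul_eq_zero_iff_right (by exact_mod_cast (Fact.out : p.Prime).ne_zero)).1 hpy
    have h := DFunLike.congr_fun hy x
    rw [hy0, map_zero, AddMonoidHom.zero_apply, CharacterModule.dual_apply,
      AddMonoidHom.comp_apply, LinearMap.toAddMonoidHom_coe, Submodule.mkQ_apply] at h
    exact h.symm
  have hzero : (Submodule.Quotient.mk (p := N) ⟨d, hd⟩ : D ⧸ N) = 0 :=
    CharacterModule.eq_zero_of_character_apply fun ψ => hvan ψ ⟨d, hd⟩
  rw [Submodule.Quotient.mk_eq_zero, hN, LinearMap.mem_range] at hzero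
  obtain ⟨d', hd'⟩ := hzero
  refine ⟨d', d'.2, ?_⟩
  rw [LinearMap.smul_apply, LinearMap.id_apply, Nat.cast_smul_eq_nsmul] at hd'
  exact congrArg Subtype.val hd'

/-- **Right non-degeneracy modulo torsion.** For a cofinitely generated `p`-primary `B`: a
character pairing to zero with all of `T_p B` is a TORSION character (it vanishes on the divisible
part `B_div`, every element of which is a component of an element of `T_p B`).
[cite: GreenbergVatsal2000, proof of Prop. 2.4 (arXiv p. 23: the dual of a divisible module is torsion-free)] -/
theorem mem_torsion_of_forall_pairing_eq_zero
    {P : TateModule B p →ₗ[ℤ_[p]] CharacterModule B →ₗ[ℤ_[p]] ℤ_[p]}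
    (hP : ∀ (t : TateModule B p) (χ : CharacterModule B) (n : ℕ) (a : ℤ),
      χ (proj p n t) = (((a : ℚ) / (p : ℚ) ^ n : ℚ) : AddCircle (1 : ℚ)) →
        PadicInt.toZModPow n (P t χ) = a)
    (hB : ∀ b : B, ∃ k : ℕ, p ^ k • b = 0) [Module.Finite ℤ_[p] (CharacterModule B)]
    {χ : CharacterModule B} (hχ : ∀ t : TateModule B p, P t χ = 0) :
    χ ∈ Submodule.torsion ℤ_[p] (CharacterModule B) := by
  obtain ⟨D, hD⟩ := BigRepModule.exists_submodule_mem_iff_torsion (p := p) (B := B)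
  refine BigRepModule.mem_torsion_of_forall_mem_iff_torsion D hD χ fun d hd => ?_
  obtain ⟨n, hn⟩ := hB d
  obtain ⟨t, ht⟩ := exists_proj_eq_of_divisible (D : Set B)
    (fun x hx => exists_smul_eq_of_mem_iff_torsion D hD x hx) hd hn
  obtain ⟨a, ha⟩ := exists_apply_proj_eq_coe_div t χ n
  have hres := hP t χ n a ha
  rw [hχ t, map_zero] at hres
  have h0' : ((((0 : ℤ) : ℚ) / (p : ℚ) ^ n : ℚ) : AddCircle (1 : ℚ)) = 0 := by simp
  rw [← ht, ha, ← h0', QpModZp.addCircle_coe_int_div_eq_coe_int_div_iff (p := p), Int.cast_zero,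
    ← hres]

/-! ## §4 The comparison map `B^∨ ⧸ tors → Hom(T_p B, ℤ_p)` -/

variable {P : TateModule B p →ₗ[ℤ_[p]] CharacterModule B →ₗ[ℤ_[p]] ℤ_[p]}

/-- The torsion characters lie in the kernel of `χ ↦ ⟨·, χ⟩`. [folklore] -/
private theorem torsion_le_ker_flip (P : TateModule B p →ₗ[ℤ_[p]] CharacterModule B →ₗ[ℤ_[p]] ℤ_[p]) :
    Submodule.torsion ℤ_[p] (CharacterModule B) ≤ LinearMap.ker P.flip := by
  intro χ hχ
  rw [LinearMap.mem_ker]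
  ext t
  rw [LinearMap.flip_apply, LinearMap.zero_apply]
  exact pairing_eq_zero_of_mem_torsion t hχ

/-- **The comparison map `ι : B^∨ ⧸ (B^∨)_tors → Hom_{ℤ_p}(T_p B, ℤ_p)` is injective** for
cofinitely generated `p`-primary `B`.
[cite: GreenbergVatsal2000, proof of Prop. 2.4 (arXiv p. 23)] -/
private theorem liftQ_flip_injective
    (hP : ∀ (t : TateModule B p) (χ : CharacterModule B) (n : ℕ) (a : ℤ),
      χ (proj p n t) = (((a : ℚ) / (p : ℚ) ^ n : ℚ) : AddCircle (1 : ℚ)) →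
        PadicInt.toZModPow n (P t χ) = a)
    (hB : ∀ b : B, ∃ k : ℕ, p ^ k • b = 0) [Module.Finite ℤ_[p] (CharacterModule B)] :
    Function.Injective
      ((Submodule.torsion ℤ_[p] (CharacterModule B)).liftQ P.flip (torsion_le_ker_flip P)) := by
  rw [← LinearMap.ker_eq_bot]
  refine Submodule.ker_liftQ_eq_bot _ _ _ fun χ hχ => ?_
  rw [LinearMap.mem_ker] at hχ
  exact mem_torsion_of_forall_pairing_eq_zero hP hB fun t => by
    rw [← LinearMap.flip_apply (f := P), hχ, LinearMap.zero_apply]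

/-- **The transposed comparison map `T_p B → Hom_{ℤ_p}(B^∨ ⧸ tors, ℤ_p)` is injective** (for any
`B`: characters of `B` separate the components of `T_p B`). [folklore] -/
private theorem flip_liftQ_flip_injective
    (hP : ∀ (t : TateModule B p) (χ : CharacterModule B) (n : ℕ) (a : ℤ),
      χ (proj p n t) = (((a : ℚ) / (p : ℚ) ^ n : ℚ) : AddCircle (1 : ℚ)) →
        PadicInt.toZModPow n (P t χ) = a) :
    Function.Injective
      ((Submodule.torsion ℤ_[p] (CharacterModule B)).liftQ P.flip (torsion_le_ker_flip P)).flip := by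
  refine (injective_iff_map_eq_zero _).2 fun t ht => eq_zero_of_forall_pairing_eq_zero hP fun χ => ?_
  have h := LinearMap.congr_fun ht (Submodule.Quotient.mk χ)
  rwa [LinearMap.flip_apply, Submodule.liftQ_apply, LinearMap.flip_apply, LinearMap.zero_apply] at h

/-- **The comparison map intertwines `Lt` (induced by `F^∨` on `B^∨ ⧸ tors`) with the transpose of
`T_p(F)`**: `ι (Lt y) = ι(y) ∘ T_p(F)`. [folklore] -/
private theorem liftQ_flip_comp_eq_dualMap_comp
    (hP : ∀ (t : TateModule B p) (χ : CharacterModule B) (n : ℕ) (a : ℤ),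
      χ (proj p n t) = (((a : ℚ) / (p : ℚ) ^ n : ℚ) : AddCircle (1 : ℚ)) →
        PadicInt.toZModPow n (P t χ) = a)
    (F : B →ₗ[ℤ_[p]] B)
    (Lt : (CharacterModule B ⧸ Submodule.torsion ℤ_[p] (CharacterModule B)) →ₗ[ℤ_[p]]
      (CharacterModule B ⧸ Submodule.torsion ℤ_[p] (CharacterModule B)))
    (hLt : ∀ χ : CharacterModule B,
      Lt (Submodule.Quotient.mk χ) = Submodule.Quotient.mk (CharacterModule.dual F χ)) :
    ((Submodule.torsion ℤ_[p] (CharacterModule B)).liftQ P.flip (torsion_le_ker_flip P)) ∘ₗ Lt =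
      (map p F.toAddMonoidHom).dualMap ∘ₗ
        ((Submodule.torsion ℤ_[p] (CharacterModule B)).liftQ P.flip (torsion_le_ker_flip P)) := by
  apply LinearMap.ext
  intro y
  obtain ⟨χ, rfl⟩ := Submodule.Quotient.mk_surjective _ y
  rw [LinearMap.comp_apply, LinearMap.comp_apply, hLt, Submodule.liftQ_apply, Submodule.liftQ_apply]
  apply LinearMap.ext
  intro t
  rw [LinearMap.flip_apply, LinearMap.dualMap_apply, LinearMap.flip_apply, pairing_map hP]

/-- **Equal ranks**: `rank_{ℤ_p}(B^∨ ⧸ tors) = rank_{ℤ_p} T_p B` for cofinitely generated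
`p`-primary `B` (two injections between finite free modules and their duals): the `e` of
"`B_v ≅ (ℚ_p/ℤ_p)^e ×` (a finite group)" is both the corank and the rank of the Tate module.
[cite: GreenbergLNM1716, §3, proof of Lemma 3.3 (B_v ≅ (ℚ_p/ℤ_p)^e × finite)]
[cite: GreenbergVatsal2000, §2, proof of Prop. (2.4) (arXiv p. 23: the dual of a divisible module is torsion-free, finitely generated, hence free)] -/
theorem finrank_quotientTorsion_characterModule_eq_finrank_tateModule
    (hP : ∀ (t : TateModule B p) (χ : CharacterModule B) (n : ℕ) (a : ℤ),
      χ (proj p n t) = (((a : ℚ) / (p : ℚ) ^ n : ℚ) : AddCircle (1 : ℚ)) →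
        PadicInt.toZModPow n (P t χ) = a)
    (hB : ∀ b : B, ∃ k : ℕ, p ^ k • b = 0) [Module.Finite ℤ_[p] (CharacterModule B)]
    [Module.Finite ℤ_[p] (TateModule B p)] [Module.Free ℤ_[p] (TateModule B p)] :
    Module.finrank ℤ_[p] (CharacterModule B ⧸ Submodule.torsion ℤ_[p] (CharacterModule B)) =
      Module.finrank ℤ_[p] (TateModule B p) := by
  apply le_antisymm
  · have h := LinearMap.finrank_le_finrank_of_injective (liftQ_flip_injective hP hB)
    rwa [Module.finrank_linearMap_self] at h
  · have h := LinearMap.finrank_le_finrank_of_injective (flip_liftQ_flip_injective (B := B) hP)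
    rwa [Module.finrank_linearMap_self] at h

end Cofinite

end TateModule

/-! ## §5 Linear algebra: intertwined lattices of the same rank have the same characteristic
polynomial; the characteristic polynomial of the transpose -/

section LinearAlgebra

variable {R : Type*} [CommRing R] [IsDomain R] {M N : Type*} [AddCommGroup M] [Module R M]
  [AddCommGroup N] [Module R N]

/-- **Intertwined lattices of equal rank have equal characteristic polynomials.** Over a domain
`R`: if `ι : N → M` is an injective linear map between finite free modules of the same rank and
`ι ∘ g = f ∘ ι`, then `charpoly g = charpoly f`. (In bases, `Q·C = A·Q` with `det Q ≠ 0`, so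
`(X − A)·Q = Q·(X − C)` in `R[X]`, take determinants and cancel `det Q`.) [folklore] -/
private theorem LinearMap.charpoly_eq_of_injective_of_finrank_eq [Module.Free R M] [Module.Finite R M]
    [Module.Free R N] [Module.Finite R N] (ι : N →ₗ[R] M) (hι : Function.Injective ι)
    (hrank : Module.finrank R N = Module.finrank R M) (f : M →ₗ[R] M) (g : N →ₗ[R] N)
    (hfg : ι ∘ₗ g = f ∘ₗ ι) : g.charpoly = f.charpoly := by
  classical
  let bM : Module.Basis (Fin (Module.finrank R M)) R M := Module.finBasisOfFinrankEq R M rfl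
  let bN : Module.Basis (Fin (Module.finrank R M)) R N := Module.finBasisOfFinrankEq R N hrank
  set A := LinearMap.toMatrix bM bM f with hA
  set C := LinearMap.toMatrix bN bN g with hC
  set Q := LinearMap.toMatrix bN bM ι with hQ
  have hAQ : A * Q = Q * C := by
    rw [hA, hQ, hC, ← LinearMap.toMatrix_comp bN bM bM f ι, ← LinearMap.toMatrix_comp bN bN bM ι g, hfg]
  have hdet : Q.det ≠ 0 := by
    intro h0
    obtain ⟨v, hv0, hv⟩ := Matrix.exists_mulVec_eq_zero_iff.2 h0
    apply hv0
    set x : N := bN.equivFun.symm v with hx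
    have hvx : ⇑(bN.repr x) = v := by
      rw [← Module.Basis.equivFun_apply, hx, LinearEquiv.apply_symm_apply]
    have h1 : bM.repr (ι x) = 0 := by
      have h2 := LinearMap.toMatrix_mulVec_repr bN bM ι x
      rw [← hQ, hvx, hv] at h2
      exact DFunLike.coe_injective (h2.symm.trans Finsupp.coe_zero.symm)
    have hιx : ι x = 0 := bM.repr.map_eq_zero_iff.1 h1
    have hx0 : x = 0 := hι (by rw [hιx, map_zero])
    rw [← hvx, hx0, map_zero, Finsupp.coe_zero]
  have key : A.charmatrix * Q.map Polynomial.C = Q.map Polynomial.C * C.charmatrix := by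
    rw [Matrix.charmatrix, Matrix.charmatrix, sub_mul, mul_sub,
      (Matrix.scalar_commute (Polynomial.X : Polynomial R) (fun _ => Commute.all _ _) _).eq,
      RingHom.mapMatrix_apply, RingHom.mapMatrix_apply, ← Matrix.map_mul, ← Matrix.map_mul, hAQ]
  have hdet' : (Q.map Polynomial.C).det ≠ 0 := by
    rw [← RingHom.mapMatrix_apply, ← RingHom.map_det]
    exact Polynomial.C_ne_zero.2 hdet
  have h := congrArg Matrix.det key
  rw [Matrix.det_mul, Matrix.det_mul] at h
  rw [← f.charpoly_toMatrix bM, ← g.charpoly_toMatrix bN, ← hA, ← hC, Matrix.charpoly,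
    Matrix.charpoly]
  exact mul_left_cancel₀ hdet' (by rw [← h, mul_comm])

/-- The transpose has the same characteristic polynomial: `charpoly f.dualMap = charpoly f`
(finite free `M`). [folklore] -/
private theorem LinearMap.charpoly_dualMap {R : Type*} [CommRing R] [Nontrivial R] {M : Type*}
    [AddCommGroup M] [Module R M] [Module.Free R M] [Module.Finite R M] (f : M →ₗ[R] M) :
    f.dualMap.charpoly = f.charpoly := by
  classical
  let b := Module.Free.chooseBasis R M
  rw [← f.charpoly_toMatrix b, ← f.dualMap.charpoly_toMatrix b.dualBasis, LinearMap.dualMap_def,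
    LinearMap.toMatrix_transpose, Matrix.charpoly_transpose]

end LinearAlgebra

/-! ## §6 The bridge: `charpoly(Lt on B^∨ ⧸ tors) = charpoly(T_p(F) on T_p B)` -/

namespace BigRepModule

open TateModule

variable {p : ℕ} [Fact p.Prime] {B : Type} [AddCommGroup B] [Module ℤ_[p] B]

/-- **THE TATE-MODULE BRIDGE.** For a `p`-primary `ℤ_p`-module `B` with finitely generated
Pontryagin dual (cofinitely generated), an endomorphism `F_B`, and `Lt` the endomorphism of
`Y = B^∨ ⧸ (B^∨)_tors` induced by `F_B^∨` (tree `exists_quotientTorsion_endo_dual`):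
`charpoly Lt = charpoly (T_p F_B)` on the Tate module `T_p B = lim B[p^n]` (free of the same rank).
Hence the generator `(charpoly Lt).reverse((1+T)^c)` of
`finite_isTorsion_charIdeal_characterModule_ker_shiftedEndo_eq_span_aeval` is
`det(1 − X·T_p(F_B) | T_p B)` evaluated at `(1+T)^c` — "`P_ℓ(X) = det((1 − Frob_ℓ X)|(V_p)_{I_ℓ})`"
computed on the Tate module. [cite: GreenbergVatsal2000, Prop. 2.4 and proof (arXiv pp. 21–23)] -/
theorem charpoly_quotientTorsion_endo_dual_eq_charpoly_tateModule_map
    (hB : ∀ b : B, ∃ k : ℕ, p ^ k • b = 0) [Module.Finite ℤ_[p] (CharacterModule B)]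
    [Module.Finite ℤ_[p] (TateModule B p)] [Module.Free ℤ_[p] (TateModule B p)]
    (F_B : B →ₗ[ℤ_[p]] B)
    (Lt : (CharacterModule B ⧸ Submodule.torsion ℤ_[p] (CharacterModule B)) →ₗ[ℤ_[p]]
      (CharacterModule B ⧸ Submodule.torsion ℤ_[p] (CharacterModule B)))
    (hLt : ∀ χ : CharacterModule B,
      Lt (Submodule.Quotient.mk χ) = Submodule.Quotient.mk (CharacterModule.dual F_B χ)) :
    LinearMap.charpoly Lt = LinearMap.charpoly (TateModule.map p F_B.toAddMonoidHom) := by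
  obtain ⟨P, hP⟩ := exists_pairing B p
  rw [← LinearMap.charpoly_dualMap (TateModule.map p F_B.toAddMonoidHom)]
  refine LinearMap.charpoly_eq_of_injective_of_finrank_eq _ (liftQ_flip_injective hP hB) ?_ _ _
    (liftQ_flip_comp_eq_dualMap_comp hP F_B Lt hLt)
  rw [Module.finrank_linearMap_self]
  exact finrank_quotientTorsion_characterModule_eq_finrank_tateModule hP hB

end BigRepModule


/-! ## §7 `T_p B` is finite free for cofinitely generated `B`; the bridge with instances supplied -/

namespace TateModule

section Instances

variable {p : ℕ} [Fact p.Prime] {B : Type} [AddCommGroup B] [Module ℤ_[p] B]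

/-- **Cofinitely generated ⟹ `B[p]` finite**: the characters of `B[p]` are a quotient of
`B^∨ ⧸ p·B^∨`, which is finite when `B^∨` is finitely generated over `ℤ_p`; a group with finitely
many characters is finite. [cite: GreenbergLNM1716, §3, proof of Lemma 3.3 (B_v ≅ (ℚ_p/ℤ_p)^e × finite)] -/
theorem finite_torsionBy_of_module_finite_characterModule [Module.Finite ℤ_[p] (CharacterModule B)] :
    Finite (AddSubgroup.torsionBy B (p : ℕ)) := by
  set S : Submodule ℤ_[p] B := Submodule.torsionBy ℤ_[p] B (p : ℤ_[p]) with hS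
  set N : Submodule ℤ_[p] (CharacterModule B) :=
    LinearMap.range ((p : ℤ_[p]) • (LinearMap.id : CharacterModule B →ₗ[ℤ_[p]] CharacterModule B))
    with hN
  have htors : Module.IsTorsion ℤ_[p] (CharacterModule B ⧸ N) := by
    intro x
    obtain ⟨χ, rfl⟩ := Submodule.Quotient.mk_surjective N x
    refine ⟨⟨(p : ℤ_[p]),
      mem_nonZeroDivisors_of_ne_zero (by exact_mod_cast (Fact.out : p.Prime).ne_zero)⟩, ?_⟩
    change (p : ℤ_[p]) • (Submodule.Quotient.mk χ : CharacterModule B ⧸ N) = 0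
    rw [← Submodule.Quotient.mk_smul, Submodule.Quotient.mk_eq_zero, hN, LinearMap.mem_range]
    exact ⟨χ, rfl⟩
  haveI : Finite (CharacterModule B ⧸ N) :=
    BigRepModule.finite_of_module_finite_of_isTorsion_padicInt _ htors
  set res : CharacterModule B →ₗ[ℤ_[p]] CharacterModule S := CharacterModule.dual S.subtype
    with hres
  have hle : N ≤ LinearMap.ker res := by
    rintro _ ⟨χ, rfl⟩
    rw [LinearMap.mem_ker, LinearMap.smul_apply, LinearMap.id_apply, LinearMap.map_smul]
    apply CharacterModule.ext
    intro s
    rw [CharacterModule.smul_apply, Submodule.smul_torsionBy, map_zero]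
    rfl
  have hsurj : Function.Surjective (N.liftQ res hle) := by
    intro ψ
    obtain ⟨χ, hχ⟩ := CharacterModule.dual_surjective_of_injective S.subtype S.injective_subtype ψ
    exact ⟨Submodule.Quotient.mk χ, by rw [Submodule.liftQ_apply, hres]; exact hχ⟩
  haveI : Finite (CharacterModule S) := Finite.of_surjective _ hsurj
  haveI : Finite (CharacterModule (CharacterModule S)) := SkinnerUrban2014.finite_characterModule _
  -- `S` embeds into its double character group
  let ev : S → CharacterModule (CharacterModule S) := fun s ↦
    { toFun := fun ψ ↦ ψ s
      map_zero' := rfl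
      map_add' := fun _ _ ↦ rfl }
  haveI : Finite S := by
    refine Finite.of_injective ev fun a b hab ↦ ?_
    have h : ∀ ψ : CharacterModule S, ψ (a - b) = 0 := fun ψ ↦ by
      rw [map_sub, sub_eq_zero]
      exact DFunLike.congr_fun (F := CharacterModule (CharacterModule S)) hab ψ
    exact sub_eq_zero.mp (CharacterModule.eq_zero_of_character_apply h)
  refine Finite.of_injective (fun x : AddSubgroup.torsionBy B (p : ℕ) => (⟨x.1, ?_⟩ : S)) ?_
  · rw [hS, Submodule.mem_torsionBy_iff, Nat.cast_smul_eq_nsmul]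
    exact AddSubgroup.torsionBy.nsmul_iff.1 x.2
  · intro x y h
    have h' := congrArg Subtype.val h
    dsimp only at h'
    exact Subtype.ext h'

/-- `T_p B` is a finitely generated `ℤ_p`-module for cofinitely generated `B` (tree
`finite_of_finite_torsionBy`). [cite: SilvermanAEC2009, Prop. III.7.1 (proof)] -/
theorem module_finite_of_module_finite_characterModule [Module.Finite ℤ_[p] (CharacterModule B)] :
    Module.Finite ℤ_[p] (TateModule B p) :=
  finite_of_finite_torsionBy finite_torsionBy_of_module_finite_characterModule

/-- `T_p B` is a free `ℤ_p`-module for cofinitely generated `B` (tree `free_of_finite_torsionBy`).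
[cite: SilvermanAEC2009, Prop. III.7.1 (proof)] -/
theorem module_free_of_module_finite_characterModule [Module.Finite ℤ_[p] (CharacterModule B)] :
    Module.Free ℤ_[p] (TateModule B p) :=
  free_of_finite_torsionBy finite_torsionBy_of_module_finite_characterModule

end Instances

/-! ## §8 `T_p(A[p^∞]) = T_p(A)`: the Tate module of the tree's `PrimaryTorsion A p` -/

section PrimaryTorsionBridge

variable {A : Type u} [AddCommGroup A] {p : ℕ} [Fact p.Prime]

/-- **`T_p(A[p^∞]) ≅ T_p(A)`** (the Tate module only sees `p`-power torsion): a `ℤ_p`-linear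
isomorphism `e` from the Tate module of the tree's `PrimaryTorsion A p` onto `T_p A`, with
components `(e t)_n = t_n ∈ A`. [cite: Serre1968, Ch. I §1.2 (`T_ℓ = lim E_{ℓⁿ}`, `E_{ℓ^∞} = ⋃ E_{ℓⁿ}`)] -/
theorem exists_linearEquiv_primaryTorsion (A : Type u) [AddCommGroup A] (p : ℕ) [Fact p.Prime] :
    ∃ e : TateModule (PrimaryTorsion A p) p ≃ₗ[ℤ_[p]] TateModule A p,
      ∀ (t : TateModule (PrimaryTorsion A p) p) (n : ℕ),
        proj p n (e t) = ((proj p n t : PrimaryTorsion A p) : A) := by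
  let v : PrimaryTorsion A p →+ A :=
    { toFun := PrimaryTorsion.val, map_zero' := rfl, map_add' := fun _ _ => rfl }
  have hbij := map_bijective_of_injective_of_forall_mem_range (p := p) v
    (fun a b h => PrimaryTorsion.ext h) (fun b n hb => ⟨PrimaryTorsion.mk b n hb, rfl⟩)
  exact ⟨LinearEquiv.ofBijective (map p v) hbij, fun t n => rfl⟩

/-- **Naturality of `T_p(A[p^∞]) ≅ T_p(A)`**: for endomorphisms `f` of `A[p^∞]` and `g` of `A`
compatible with the inclusion (`(f x : A) = g x`), `e ∘ T_p(f) = T_p(g) ∘ e` ("on which `G` acts").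
[cite: Serre1968, Ch. I §1.2 (`T_ℓ = lim E_{ℓⁿ}`, `E_{ℓ^∞} = ⋃ E_{ℓⁿ}`, with the action of `G`)] -/
theorem linearEquiv_primaryTorsion_map (e : TateModule (PrimaryTorsion A p) p ≃ₗ[ℤ_[p]] TateModule A p)
    (he : ∀ (t : TateModule (PrimaryTorsion A p) p) (n : ℕ),
      proj p n (e t) = ((proj p n t : PrimaryTorsion A p) : A))
    (f : PrimaryTorsion A p →+ PrimaryTorsion A p) (g : A →+ A)
    (hfg : ∀ x : PrimaryTorsion A p, ((f x : PrimaryTorsion A p) : A) = g x)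
    (t : TateModule (PrimaryTorsion A p) p) :
    e (map p f t) = map p g (e t) := by
  refine TateModule.ext fun n => ?_
  rw [he, proj_map, hfg, proj_map, he]

/-- **`charpoly T_p(f) = charpoly T_p(g)`** for compatible endomorphisms `f` of `A[p^∞]` and `g` of
`A` (e.g. a Galois automorphism on `E(K̄)[p^∞]` and on `E(K̄)`: the tree's
`primaryTorsionGaloisRep` vs `galoisRepTate`).
[cite: Serre1968, Ch. I §1.2 (`T_ℓ = lim E_{ℓⁿ}`, `E_{ℓ^∞} = ⋃ E_{ℓⁿ}`, with the action of `G`)] -/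
theorem charpoly_map_primaryTorsion_eq_charpoly_map
    [Module.Finite ℤ_[p] (TateModule (PrimaryTorsion A p) p)] [Module.Free ℤ_[p] (TateModule (PrimaryTorsion A p) p)]
    [Module.Finite ℤ_[p] (TateModule A p)] [Module.Free ℤ_[p] (TateModule A p)]
    (f : PrimaryTorsion A p →+ PrimaryTorsion A p) (g : A →+ A)
    (hfg : ∀ x : PrimaryTorsion A p, ((f x : PrimaryTorsion A p) : A) = g x) :
    (map p f).charpoly = (map p g).charpoly := by
  obtain ⟨e, he⟩ := exists_linearEquiv_primaryTorsion A p
  have hconj : e.conj (map p f) = map p g := by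
    apply LinearMap.ext
    intro x
    obtain ⟨t, rfl⟩ := e.surjective x
    rw [LinearEquiv.conj_apply, LinearMap.comp_apply, LinearMap.comp_apply, LinearEquiv.coe_coe,
      LinearEquiv.coe_coe, e.symm_apply_apply, linearEquiv_primaryTorsion_map e he f g hfg]
  rw [← hconj, LinearEquiv.charpoly_conj]

/-- `T_p(A[p^∞])` is finitely generated when `T_p(A)` is ("`T_ℓ` is a free `ℤ_ℓ`-module").
[cite: Serre1968, Ch. I §1.2] -/
theorem module_finite_primaryTorsion [Module.Finite ℤ_[p] (TateModule A p)] :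
    Module.Finite ℤ_[p] (TateModule (PrimaryTorsion A p) p) := by
  obtain ⟨e, -⟩ := exists_linearEquiv_primaryTorsion A p
  exact Module.Finite.equiv e.symm

/-- `T_p(A[p^∞])` is free when `T_p(A)` is ("`T_ℓ` is a free `ℤ_ℓ`-module"). [cite: Serre1968, Ch. I §1.2] -/
theorem module_free_primaryTorsion [Module.Free ℤ_[p] (TateModule A p)] :
    Module.Free ℤ_[p] (TateModule (PrimaryTorsion A p) p) := by
  obtain ⟨e, -⟩ := exists_linearEquiv_primaryTorsion A p
  exact Module.Free.of_equiv e.symm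

end PrimaryTorsionBridge

end TateModule

namespace BigRepModule

/-- **The Tate-module bridge with the instances supplied** (only `B` `p`-primary and
`[Module.Finite ℤ_[p] (CharacterModule B)]` assumed): `charpoly Lt = charpoly (T_p F_B)`.
[cite: GreenbergVatsal2000, Prop. 2.4 and proof (arXiv pp. 21–23)] -/
theorem charpoly_quotientTorsion_endo_dual_eq_charpoly_tateModule_map'
    {p : ℕ} [Fact p.Prime] {B : Type} [AddCommGroup B] [Module ℤ_[p] B]
    (hB : ∀ b : B, ∃ k : ℕ, p ^ k • b = 0) [Module.Finite ℤ_[p] (CharacterModule B)]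
    (F_B : B →ₗ[ℤ_[p]] B)
    (Lt : (CharacterModule B ⧸ Submodule.torsion ℤ_[p] (CharacterModule B)) →ₗ[ℤ_[p]]
      (CharacterModule B ⧸ Submodule.torsion ℤ_[p] (CharacterModule B)))
    (hLt : ∀ χ : CharacterModule B,
      Lt (Submodule.Quotient.mk χ) = Submodule.Quotient.mk (CharacterModule.dual F_B χ)) :
    haveI := TateModule.module_finite_of_module_finite_characterModule (p := p) (B := B)
    haveI := TateModule.module_free_of_module_finite_characterModule (p := p) (B := B)
    LinearMap.charpoly Lt = LinearMap.charpoly (TateModule.map p F_B.toAddMonoidHom) := by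
  haveI := TateModule.module_finite_of_module_finite_characterModule (p := p) (B := B)
  haveI := TateModule.module_free_of_module_finite_characterModule (p := p) (B := B)
  exact charpoly_quotientTorsion_endo_dual_eq_charpoly_tateModule_map hB F_B Lt hLt

end BigRepModule

end Literature.NumberTheory.EllipticCurves

end
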